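import Summits.SmoothPoincare4.SmoothPoincare4.Theorems.ConvexBisectionPlanarBisectionExistsSeamConnected
import Literature.Geometry.Symplectic.SteinMorsePerturbation
import Literature.Geometry.Symplectic.SteinMorseIndex

/-!
# `PlanarBisectionExists` — support: connected seams, UNCONDITIONALLY

The results of `Theorems/ConvexBisectionPlanarBisectionExistsSeamConnected.lean` (the seam of
every Stein bisection of a connected 4-manifold is connected; the `IsConnected` conjunct of the
item `Summit.SmoothPoincare4.SmoothPoincare4.Theses.ConvexBisection.PlanarBisectionExists`,
stmt-SmoothPoincare4-10512, is redundant) were stated modulo the named fact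
`Literature.Geometry.Symplectic.Gompf1998_thm13_indexLE_two` (a compact Stein domain is a
2-handlebody).  On the Stein domains that occur, that hypothesis is supplied by composing two
PROVED bricks of the tree — `SteinStructure.exists_isMorseAdapted_levi_pos`
(`SteinMorsePerturbation.lean`: a strictly `J`-convex Morse function adapted to `∂W`) and
`SteinStructure.isHandlebodyOfIndexLE_two_of_isMorseAdapted` (`SteinMorseIndex.lean`: such a
function presents `W` as a 2-handlebody) — so everything holds unconditionally:

* `isConnected_seam`, `isConnected_seam_of_homotopyEquiv_sphere` — the seam of every witness
  over a connected `M` (over a homotopy 4-sphere) is connected;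
* `isPreconnected_boundary_inter_connectedComponent'` — components of a compact Stein domain have
  connected nonempty boundary;
* `planarBisectionExists_iff_planar` — `PlanarBisectionExists ↔ ∀ M ≃ₕ S⁴, ∃ B : Witness M,
  PlanarContactBoundary B.J₁` (no seam condition);
* `steinBisectionExists_iff_connected` — `SteinBisectionExists` already provides connected seams.

(The discharge of the named fact itself, as a Literature theorem, is the business of its fact
seat; here the two bricks are only composed inside the proofs.)
-/

noncomputable section

-- the prescribed namespace `Summit.<P>.<Sub>.…` duplicates `SmoothPoincare4` (P = Sub)
set_option linter.dupNamespace false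

open scoped Manifold ContDiff Topology ContinuousMap
open Set Function
open Literature.Geometry.Symplectic Literature.Topology.FourManifolds

namespace Summit.SmoothPoincare4.SmoothPoincare4.Theorems.PlanarBisectionExists

open Summit.SmoothPoincare4.SmoothPoincare4.Theses.ConvexBisection
open Summit.SmoothPoincare4.SmoothPoincare4.Theorems.AcyclicBisectionExists.Negative

variable {M : Type} [TopologicalSpace M] [T2Space M] [SecondCountableTopology M]
  [ChartedSpace (EuclideanSpace ℝ (Fin 4)) M]

/-- **The seam of every Stein bisection of a connected 4-manifold is connected**
(unconditional form of `isConnected_seam_of_gompf`). [folklore] -/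
theorem isConnected_seam [ConnectedSpace M] (B : Witness M) : IsConnected B.seam := by
  refine isConnected_seam_of_gompf (fun W _ _ _ _ _ _ h => ?_) B
  obtain ⟨S⟩ := h
  obtain ⟨g, hg, hconv⟩ := S.exists_isMorseAdapted_levi_pos
  exact S.isHandlebodyOfIndexLE_two_of_isMorseAdapted hg hconv

/-- **Over a homotopy 4-sphere the seam of every witness is connected** (unconditional form of
`isConnected_seam_of_homotopyEquiv`). [folklore] -/
theorem isConnected_seam_of_homotopyEquiv_sphere
    (e : M ≃ₕ (Metric.sphere (0 : EuclideanSpace ℝ (Fin 5)) 1)) (B : Witness M) :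
    IsConnected B.seam := by
  refine isConnected_seam_of_homotopyEquiv (fun W _ _ _ _ _ _ h => ?_) e B
  obtain ⟨S⟩ := h
  obtain ⟨g, hg, hconv⟩ := S.exists_isMorseAdapted_levi_pos
  exact S.isHandlebodyOfIndexLE_two_of_isMorseAdapted hg hconv

/-- **The connectedness conjunct of the item is redundant, unconditionally**:
`PlanarBisectionExists ↔` every smooth `M ≃ₕ S⁴` carries a Stein bisection along a common contact
seam whose first half has planar contact boundary. [folklore] -/
theorem planarBisectionExists_iff_planar :
    PlanarBisectionExists ↔
      ∀ (M : Type) [TopologicalSpace M] [T2Space M] [SecondCountableTopology M]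
        [ChartedSpace (EuclideanSpace ℝ (Fin 4)) M] [IsManifold (𝓡 4) ∞ M],
        M ≃ₕ (Metric.sphere (0 : EuclideanSpace ℝ (Fin 5)) 1) →
          ∃ B : Witness M, PlanarContactBoundary B.J₁ := by
  refine planarBisectionExists_iff_of_gompf (fun W _ _ _ _ _ _ h => ?_)
  obtain ⟨S⟩ := h
  obtain ⟨g, hg, hconv⟩ := S.exists_isMorseAdapted_levi_pos
  exact S.isHandlebodyOfIndexLE_two_of_isMorseAdapted hg hconv

/-- **`SteinBisectionExists` already provides connected seams, unconditionally**: only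
planarity separates the item from support item `SteinBisectionExists`
(stmt-SmoothPoincare4-10509). [folklore] -/
theorem steinBisectionExists_iff_connected :
    SteinBisectionExists ↔
      ∀ (M : Type) [TopologicalSpace M] [T2Space M] [SecondCountableTopology M]
        [ChartedSpace (EuclideanSpace ℝ (Fin 4)) M] [IsManifold (𝓡 4) ∞ M],
        M ≃ₕ (Metric.sphere (0 : EuclideanSpace ℝ (Fin 5)) 1) →
          ∃ B : Witness M, IsConnected B.seam := by
  refine steinBisectionExists_iff_connected_of_gompf (fun W _ _ _ _ _ _ h => ?_)
  obtain ⟨S⟩ := h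
  obtain ⟨g, hg, hconv⟩ := S.exists_isMorseAdapted_levi_pos
  exact S.isHandlebodyOfIndexLE_two_of_isMorseAdapted hg hconv

/-- **Components of a compact Stein domain have connected nonempty boundary, unconditionally**
(unconditional form of `isPreconnected_boundary_inter_connectedComponent`). [folklore] -/
theorem isPreconnected_boundary_inter_connectedComponent' {W : Type} [TopologicalSpace W]
    [T2Space W] [SecondCountableTopology W] [CompactSpace W]
    [ChartedSpace (EuclideanHalfSpace 4) W] [IsManifold (𝓡∂ 4) ∞ W]
    (S : SteinStructure W) (w : W) :
    IsPreconnected ((𝓡∂ 4).boundary W ∩ connectedComponent w) ∧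
      ((𝓡∂ 4).boundary W ∩ connectedComponent w).Nonempty := by
  refine isPreconnected_boundary_inter_connectedComponent (fun W _ _ _ _ _ _ h => ?_) S w
  obtain ⟨S⟩ := h
  obtain ⟨g, hg, hconv⟩ := S.exists_isMorseAdapted_levi_pos
  exact S.isHandlebodyOfIndexLE_two_of_isMorseAdapted hg hconv

end Summit.SmoothPoincare4.SmoothPoincare4.Theorems.PlanarBisectionExists
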